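import Summits.ResolutionOfSingularities.ResolutionOfSingularities.Theorems.SplitCutKernels
import HarnessLib

/-!
# SplitCutKernels2 — decomp-res node «SplitCut» (lens-2 g17), file 2/2 of `SplitCutKernels`

Content VERBATIM from the decomp-res lens-2 g17 node `HOME/decomp-res-lens-2/g17/SplitCut.lean` (pin 301f7a3a, 2 469
l; parts in `g17/parts/`, SHA256SUMS verified by the critic;
HOME = run/shared/lean/pub/decomp-res; CRITIC-LEDGER row 146 (claim DECIDED-MOD-PORT(M+) +1 under row 140's window
(ii)); landing orders INBOX :365: land AFTER the PurityCut
chain with ALL restated sections (§R16, §R, §G, §P, §H — l. 244–2018: the lens's verbatim-in-body copies of lens-2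
g14 `PinchCut`, g15 `JetCut` rev 5 and g16 `PurityCut` rev 1)
DELETED and the landed modules imported instead (namespaces `…Theorems.PinchCut`, `…Theorems.JetCut` (+ `Vast`),
`…Theorems.PurityCut` (+ `Leaf`, `Grand`) opened; same short
names, byte-identical bodies — never two copies).  Namespace `…Theorems.SplitCut` (the lens's `Theses.SplitCut` is
gate-reserved), sub-namespace `Split` as in the lens;
file split only (tree files ≤ 400 lines): sections, variables and every declaration exactly as in the lens; the
node's global dupNamespace-linter line dropped.  Node files,
in import order: `SplitCutKernels` (§S1) · `SplitCutClasses` (§S2 + the cone-free head of §T) · `SplitCutCells`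
(§T2–§T4 cone-free: the aside home) · the wiring
`MaxContactCutSplitCut` (§T BY NAME on the host route, in the Theses cone).  All `--supports
stmt-ResolutionOfSingularities-29273` (`MaxContactCut.RungOne`); nothing closes
29273 — decided halves carry their engines as hypotheses; exactly ONE located-residual aside on the lens-2 column
(`Split.SplitSpecialRung`, home `SplitCutCells`) SUPERSEDES
g16's `Grand.GrandSpecialRung`, re-located EXACTLY modulo the split decided half (`grandSpecialRung_iff_splitSpecialRung`).

§S1 (NEW, g17): LAW (S) — SPLIT CONES in the ring: `splitCone`, the chart identities `splitCone_chartW` /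
`splitCone_chartU` / `splitCone_chartZ`, `split_chart_identity`, `splitCone_two` / `splitCone_three`,
`binomGuard_of_charP_pow`, `no_middle_terms`, `tail_R1_mem_wtIdeal`, `represent_R1`, `splitConeShape_R1`,
`represent_R3` — the binary form along the curve is NOT an `n`-th power of a linear form: a split cone; PROVED
kernels, VERBATIM.

Part 2/2 carries: `splitCone_chartU`, `splitCone_chartZ`, `splitCone_two`, `splitCone_three`,
`binomGuard_of_charP_pow`, `no_middle_terms`, `tail_R1_mem_wtIdeal`, `represent_R1`, `splitConeShape_R1`, `represent_R3`.

(Sources: Hironaka1964 Ch. III; CossartJannsenSaito2020 Ch. 2, Ch. 8–9; CossartPiltant2008 Prop. 4.2;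
CossartPiltant2019 Rem. 3.2; BierstoneGrigorievMilmanWlodarczyk2011 §3.1; Moh1987; Hauser2010Kangaroo; Giraud1975;
Narasimhan1983.)
-/

open CategoryTheory AlgebraicGeometry TopologicalSpace IsLocalRing
open Literature.AlgebraicGeometry.Resolution
open Summit.ResolutionOfSingularities.ResolutionOfSingularities.Theorems
open Summit.ResolutionOfSingularities.ResolutionOfSingularities.Theorems.WeakOrderReduction
open Summit.ResolutionOfSingularities.ResolutionOfSingularities.Theorems.DeltaFaceCutClasses
open Summit.ResolutionOfSingularities.ResolutionOfSingularities.Theorems.RelativeDeltaCut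
open Summit.ResolutionOfSingularities.ResolutionOfSingularities.Theorems.CurveLeafExit
open Summit.ResolutionOfSingularities.ResolutionOfSingularities.Theorems.PinchCut
open Summit.ResolutionOfSingularities.ResolutionOfSingularities.Theorems.JetCut
open Summit.ResolutionOfSingularities.ResolutionOfSingularities.Theorems.PurityCut

namespace Summit.ResolutionOfSingularities.ResolutionOfSingularities.Theorems.SplitCut

section SplitRing

variable {R : Type} [CommRing R]

section SplitKernel

/-- **`U`-CHART IDENTITY** [g17; KERNEL (PROVED)]: `z = U·X₀` factors `Uⁿ` off the cone, leaving the polynomial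
`Σ G_j X₀^{n-j}` — over the core its value at a point `x₀ ≠ 0` is the unit `x₀ⁿ` (all `G_j ∈ 𝔪`, `j ≥ 1`), at `x₀ =
0` (the point
at infinity of the fibre line) its initial form carries the middle monomial `ū ϖ̄^e X̄₀^{n-j}`. [folklore] -/
theorem splitCone_chartU (G : ℕ → R) (U X₀ : R) (n : ℕ) :
    splitCone (U * X₀) U G n = U ^ n * splitCone X₀ 1 G n := by
  simpa using splitCone_chartW G U X₀ 1 n

/-- **`z`-CHART IDENTITY** [g17; KERNEL (PROVED)]: `U = z·X₁` factors `zⁿ` off the cone, leaving `Σ G_j X₁^j ≡ G 0 =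
1` modulo the
maximal ideal of the chart origin: the `z`-chart point over the core is OFF the transform. [folklore] -/
theorem splitCone_chartZ (G : ℕ → R) (z X₁ : R) (n : ℕ) :
    splitCone z (z * X₁) G n = z ^ n * splitCone 1 X₁ G n := by
  simpa using splitCone_chartW G z 1 X₁ n

/-- The split cone for `n = 2` written out: `z² + G₁·zU + G₂·U²`.  KERNEL (PROVED). [folklore] -/
theorem splitCone_two (z U : R) (G : ℕ → R) : splitCone z U G 2 = G 0 * z ^ 2 + G 1 * (z * U) + G 2 * U ^ 2 := by
  simp [splitCone, Finset.sum_range_succ]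
  ring

/-- The split cone for `n = 3` written out.  KERNEL (PROVED). [folklore] -/
theorem splitCone_three (z U : R) (G : ℕ → R) :
    splitCone z U G 3 = G 0 * z ^ 3 + G 1 * (z ^ 2 * U) + G 2 * (z * U ^ 2) + G 3 * U ^ 3 := by
  simp [splitCone, Finset.sum_range_succ]
  ring

/-- **THE GUARD FROM THE CHARACTERISTIC** [g17; KERNEL (PROVED)]: over any commutative ring of prime characteristic `p`, every
middle binomial coefficient of `p^s` vanishes, so `BinomGuard M (p^s)` holds for EVERY ideal `M` (in the frame: `n = p^s`).
[Mathlib `Nat.Prime.dvd_choose_pow`] [folklore] -/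
theorem binomGuard_of_charP_pow (M : Ideal R) (p : ℕ) [hp : Fact p.Prime] [CharP R p] (s : ℕ) :
    BinomGuard M (p ^ s) := by
  intro i hi hin
  have hdvd : p ∣ (p ^ s).choose i :=
    hp.out.dvd_choose_pow (Nat.pos_iff_ne_zero.mp hi) (Nat.ne_of_lt hin)
  rw [(CharP.cast_eq_zero_iff R p _).mpr hdvd]
  exact M.zero_mem

/-- **NO MIDDLE TERMS IN AN `n`-TH POWER under the guard** [KERNEL (PROVED), the binary-form lemma's engine]: in
characteristic `p`,
`(x + y)^(p^s) = x^(p^s) + y^(p^s)` — so a binary form with a non-zero middle coefficient is never `λ·ℓ^(p^s)`, i.e. has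
multiplicity `< p^s` at every point `≠ 0` and, as an initial form, `τ ≥ 2`. [Mathlib `add_pow_char_pow`] [folklore] -/
theorem no_middle_terms (p : ℕ) [Fact p.Prime] [CharP R p] (s : ℕ) (x y : R) :
    (x + y) ^ p ^ s = x ^ p ^ s + y ^ p ^ s :=
  add_pow_char_pow ..

/-- **THE INHABITANT's TAIL IS A WEIGHT TAIL** [g17; KERNEL (PROVED), any commutative ring]: with `c = (z, U, W)` and
`u₂ = U + W` (characteristic 2: `U = u₁ + u₂`, `W = u₁`), the tail `u₂⁷ = (U + W)⁷` lies in `Wt(c; 2, 5, 11)`: its monomials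
`U^i W^(7−i)` have weight `5i + 2(7 − i) = 14 + 3i ≥ 11`.  It contains `U⁷` — the `U`-killer that makes the curve Top-isolated
(control row `R1-notail`: without it `Top ⊋ C`). [folklore] -/
theorem tail_R1_mem_wtIdeal (c : Fin 3 → R) : (c 1 + c 2) ^ 7 ∈ WtIdeal c 2 5 (2 * 5 + 1) := by
  rw [add_pow]
  refine Ideal.sum_mem _ (fun i hi => ?_)
  have hi7 : i ≤ 7 := Nat.lt_succ_iff.mp (Finset.mem_range.mp hi)
  refine Ideal.mul_mem_right _ _ (Ideal.subset_span ⟨0, i, 7 - i, by omega, by ring⟩)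

/-- **THE INHABITANT PRESENTED** [g17; KERNEL (PROVED), characteristic 2]: census row `R1 = z² + v·z·(u₁+u₂) + u₁⁵ + u₂⁷` over
`𝔽₂` IS a split cone with `c = (z, U, W) = (z, u₁ + u₂, u₁)`, `G = (1, v, 0)` (middle coefficient `v = 1·ϖ¹`, `ϖ = v`
transversal; NO vertex monomial), `ε = 1`, `k = 5`, tail `u₂⁷ = (U + W)⁷`. [folklore] -/
theorem represent_R1 (z v u₁ u₂ : MvPolynomial (Fin 4) (ZMod 2)) :
    z ^ 2 + v * z * (u₁ + u₂) + u₁ ^ 5 + u₂ ^ 7 =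
      splitCone z (u₁ + u₂) (fun j => if j = 0 then 1 else if j = 1 then v else 0) 2 + 1 * u₁ ^ 5 +
        ((u₁ + u₂) + u₁) ^ 7 := by
  have h2 : (2 : MvPolynomial (Fin 4) (ZMod 2)) = 0 := by
    simpa using CharP.cast_eq_zero (MvPolynomial (Fin 4) (ZMod 2)) 2
  have hu : (u₁ + u₂) + u₁ = u₂ := by linear_combination u₁ * h2
  rw [hu, splitCone_two]
  simp
  ring

/-- **THE INHABITANT's COMPLETE RING-LEVEL SHAPE CERTIFICATE** [g17; KERNEL (PROVED)]: in the polynomial model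
`𝔽₂[z, v, u₁, u₂]` with `M = (z, U, W, v)`, `c = (z, U, W)`, `U = u₁ + u₂`, `W = u₁`, `ϖ = v`, the germ `R1` satisfies EVERY
clause of `SplitConeShape M c v G 1 (u₂⁷) R1 2 5`: presentation (`represent_R1`), `G 0 = 1`, middle coefficient (`j
= e = 1`, `u = 1`,
`(c, v) = M`), vertex clause (`G 2 = 0`), `ε = 1` a unit, weight tail (`tail_R1_mem_wtIdeal`), `2 ≤ 5`, `2 ∤ 5`, and the guard
(`binomGuard_of_charP_pow`, `2 = 2¹`).  The same presentation holds verbatim in the stalk at the core (localise). [folklore] -/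
theorem splitConeShape_R1 (z v u₁ u₂ : MvPolynomial (Fin 4) (ZMod 2)) :
    SplitConeShape (Ideal.span (Set.range ![z, u₁ + u₂, u₁] ∪ {v})) ![z, u₁ + u₂, u₁] v
      (fun j => if j = 0 then 1 else if j = 1 then v else 0) 1 (u₂ ^ 7)
      (z ^ 2 + v * z * (u₁ + u₂) + u₁ ^ 5 + u₂ ^ 7) 2 5 := by
  have h2 : (2 : MvPolynomial (Fin 4) (ZMod 2)) = 0 := by
    simpa using CharP.cast_eq_zero (MvPolynomial (Fin 4) (ZMod 2)) 2
  have hu : (u₁ + u₂) + u₁ = u₂ := by linear_combination u₁ * h2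
  refine ⟨?_, by simp, ?_, ?_, isUnit_one, ?_, by norm_num, by norm_num, ?_⟩
  · -- presentation
    have := represent_R1 z v u₁ u₂
    simpa [hu] using this
  · -- middle coefficient: j = 1, e = 1, u = 1, ϖ = v transversal
    exact ⟨1, 1, 1, by norm_num, by norm_num, le_rfl, isUnit_one, by simp, Or.inl rfl⟩
  · -- vertex clause: G 2 = 0 ∈ M
    exact Or.inl (by simp)
  · -- weight tail: u₂⁷ = (U + W)⁷ ∈ Wt(c; 2, 5, 11)
    have h := tail_R1_mem_wtIdeal (R := MvPolynomial (Fin 4) (ZMod 2)) ![z, u₁ + u₂, u₁]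
    simpa [hu] using h
  · -- the guard: 2 = 2¹ in characteristic 2
    simpa using binomGuard_of_charP_pow (Ideal.span (Set.range ![z, u₁ + u₂, u₁] ∪ {v})) 2 1

/-- **THE p = 3 INHABITANT PRESENTED** [g17; KERNEL (PROVED), characteristic 3]: census row
`R3 = z³ + 2v²z(u₁+u₂)² + u₁⁷ + u₂⁸` over `𝔽₃` is the split cone `z(z − vU)(z + vU)` (`G = (1, 0, −v², 0)`: middle coefficient
`G 2 = (−1)·v²`, `e = j = 2`; no vertex monomial) plus `W⁷ + (U − W)⁸`, `c = (z, u₁ + u₂, u₁)`, `k = 7`. [folklore] -/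
theorem represent_R3 (z v u₁ u₂ : MvPolynomial (Fin 4) (ZMod 3)) :
    z ^ 3 + 2 * v ^ 2 * z * (u₁ + u₂) ^ 2 + u₁ ^ 7 + u₂ ^ 8 =
      splitCone z (u₁ + u₂) (fun j => if j = 0 then 1 else if j = 2 then -v ^ 2 else 0) 3 + 1 * u₁ ^ 7 +
        ((u₁ + u₂) - u₁) ^ 8 := by
  have h3 : (3 : MvPolynomial (Fin 4) (ZMod 3)) = 0 := by
    simpa using CharP.cast_eq_zero (MvPolynomial (Fin 4) (ZMod 3)) 3
  rw [splitCone_three]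
  simp
  linear_combination (v ^ 2 * z * (u₁ + u₂) ^ 2) * h3

end SplitKernel

end SplitRing

end Summit.ResolutionOfSingularities.ResolutionOfSingularities.Theorems.SplitCut
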